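import Literature.AlgebraicGeometry.HodgeTheory.HodgeClassOfMorphismProofs
import Literature.AlgebraicGeometry.HodgeTheory.LefschetzOneOneHolds
import HarnessLib

/-!
# Crux `ConiveauOneFailure` (stmt-HodgeConjecture-3540), route `SecondaryPeriods`, line `birth` —
# stub `stub_surjective_algebraic_corrAction_of_hodgeMap` (S2b₂): a surjective Hodge map
# `H¹(C) ↠ H¹(S)` is split off by a surjective ALGEBRAIC correspondence

Helper file for the line skeleton `Cruxes/ConiveauOneFailure/Lines/birth.lean` (gen 2) of the
negative-side crux `ConiveauOneFailure = ¬ LevelOneConiveauThreefolds` of route `SecondaryPeriods`,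
registered stub `stub_surjective_algebraic_corrAction_of_hodgeMap` (S2b₂), proved UNCONDITIONALLY.

**Statement.** Let `S` be a smooth projective surface and `C` a smooth projective curve over `ℂ`,
with Hodge models `A` of `S` and `B` of `C`, and let `φ : H¹(C(ℂ); ℂ) → H¹(S(ℂ); ℂ)` be a SURJECTIVE
`ℂ`-linear map sending rational classes to rational classes and classes of type `(p, q)` (read in
`B`) to classes of type `(p, q)` (read in `A`). Then for every orientation family `μ` there is an
ALGEBRAIC class `γ ∈ N¹H²((S ⊗ C)(ℂ); ℂ) = algebraicClasses (S ⊗ C) 1` whose action as a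
correspondence `[γ]_* = corrAction μ hS hC _ γ : H¹(C(ℂ)) → H¹(S(ℂ))`, `c ↦ pr_{S*}(pr_C^* c ∪ γ)`,
is surjective.

**Proof.** Voisin I, Lemma 11.41 on the tree's carriers
(`exists_rational_hodgeClass_corrAction_eq_smul`, with `a = b = 1`, `e = 1`, `r = 0`): there is a
rational class `γ ∈ H²((S ⊗ C)(ℂ); ℂ)` of Hodge type `(1, 1)` on the threefold `S ⊗ C` and `t ≠ 0`
with `[γ]_* = t • φ`. By the Lefschetz theorem on `(1,1)`-classes (`lefschetzOneOne_rational_holds`,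
Voisin I Thm. 11.30, applied to `S ⊗ C`, smooth projective of dimension `2 + 1` by
`IsSmoothProjective.tensor_holds`) `γ` is algebraic, and `t • φ` is onto because `φ` is and `t ≠ 0`.

Everything used is proved in the tree or in Mathlib; no named fact is taken as a hypothesis and
none is introduced.

References: C. Voisin, *Hodge Theory and Complex Algebraic Geometry I* (CUP 2002), §11.3.3
Lemma 11.41, Thm. 11.30 and Cor. 11.34; A. Grothendieck, *Hodge's general conjecture is false for
trivial reasons*, Topology 8 (1969), p. 301.
-/

-- `Summit.HodgeConjecture.HodgeConjecture.Theorems` is the mandated namespace (single-conjunct summit: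
-- Sub = Summit), which `linter.dupNamespace` flags on every declaration; the lakefile turns the
-- linter off tree-wide (weak option), restated here so stand-alone elaboration is warning-free too.
set_option linter.dupNamespace false

noncomputable section

namespace Summit.HodgeConjecture.HodgeConjecture.Theorems

open CategoryTheory MonoidalCategory CartesianMonoidalCategory
open Literature.AlgebraicGeometry.Motives Literature.AlgebraicGeometry.HodgeTheory
open Literature.AlgebraicTopology.SingularHomology

/-! ### A linear-algebra helper -/

/-- A non-zero scalar multiple of a surjective linear map is surjective: for `y`, pick `x` with
`φ x = t⁻¹ • y`; then `(t • φ) x = t • t⁻¹ • y = y`. [folklore] -/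
private theorem surjective_smul_linearMap_of_surjective {V W : Type*} [AddCommGroup V] [Module ℂ V]
    [AddCommGroup W] [Module ℂ W] {φ : V →ₗ[ℂ] W} (hφ : Function.Surjective φ) {t : ℂ} (ht : t ≠ 0) :
    Function.Surjective (t • φ) := by
  intro y
  obtain ⟨x, hx⟩ := hφ (t⁻¹ • y)
  exact ⟨x, by rw [LinearMap.smul_apply, hx, smul_smul, mul_inv_cancel₀ ht, one_smul]⟩

/-! ### The stub -/

/-- **STUB S2b₂ `stub_surjective_algebraic_corrAction_of_hodgeMap` of the crux `ConiveauOneFailure`,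
line `birth` — a surjective Hodge map `H¹(C) ↠ H¹(S)` is, up to a non-zero scalar, the action of
an ALGEBRAIC divisor class on `S ⊗ C`.** For a smooth projective surface `S`, a smooth projective
curve `C`, Hodge models `A`, `B`, and `φ : H¹(C(ℂ); ℂ) ↠ H¹(S(ℂ); ℂ)` surjective, rational and of
type `(0, 0)`, and every orientation family `μ`: Voisin I Lemma 11.41
(`exists_rational_hodgeClass_corrAction_eq_smul hS hC A B (1 + 2·1 = 1 + 2·1) (1 + 0 = 1) φ …`)
gives a rational class `γ ∈ H²((S ⊗ C)(ℂ); ℂ)` of Hodge type `(1, 1)` with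
`corrAction μ hS hC _ γ = t • φ`, `t ≠ 0`; Lefschetz `(1,1)` (`lefschetzOneOne_rational_holds` on the
threefold `S ⊗ C`, `IsSmoothProjective.tensor_holds hS hC`) puts `γ` in
`algebraicClasses (S ⊗ C) 1 = N¹H²`; and `t • φ` is onto.
[cite: VoisinHodgeI2002, §11.3.3 Lemma 11.41 and Thm. 11.30 (Lefschetz (1,1))] -/
theorem stub_surjective_algebraic_corrAction_of_hodgeMap :
    ∀ ⦃S C : SchemeOver ℂ⦄ (hS : IsSmoothProjective 2 S) (hC : IsSmoothProjective 1 C)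
      (A : HodgeModel 2 S) (B : HodgeModel 1 C) (φ : complexBetti C 1 →ₗ[ℂ] complexBetti S 1),
      (∀ c, IsRationalClass c → IsRationalClass (φ c)) →
      (∀ (p q : ℕ), p + q = 1 → ∀ c, B.pullback 1 c ∈ B.hodgePQ 1 p q →
        A.pullback 1 (φ c) ∈ A.hodgePQ 1 p q) →
      Function.Surjective φ → ∀ μ : OrientationFamily,
        ∃ γ ∈ algebraicClasses (S ⊗ C) 1,
          Function.Surjective (corrAction μ hS hC (show 1 + 2 * 1 = 1 + 2 * 1 from rfl) γ) := by
  intro S C hS hC A B φ hφ hφH hsurj μ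
  -- Voisin I, Lemma 11.41 (`a = b = 1`, `e = 1`, `r = 0`): `[γ]_* = t • φ`, `γ` rational of type `(1,1)`.
  obtain ⟨γ, hγrat, hγH, t, ht, heq⟩ :=
    exists_rational_hodgeClass_corrAction_eq_smul hS hC A B (show 1 + 2 * 1 = 1 + 2 * 1 from rfl)
      (show 1 + 0 = 1 from rfl) φ hφ
      (fun p q h c hc ↦ by simpa only [Nat.add_zero] using hφH p q h c hc) μ
  -- Lefschetz `(1,1)` on the threefold `S ⊗ C`: `γ` is algebraic.
  refine ⟨γ, lefschetzOneOne_rational_holds (IsSmoothProjective.tensor_holds hS hC) γ hγrat hγH, ?_⟩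
  -- `t • φ` is onto.
  rw [heq]
  exact surjective_smul_linearMap_of_surjective hsurj ht

end Summit.HodgeConjecture.HodgeConjecture.Theorems

end
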